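import Summits.BirchSwinnertonDyer.BirchSwinnertonDyer.Theorems.AdditiveKolyvaginRoadLevelDefs
import Summits.BirchSwinnertonDyer.BirchSwinnertonDyer.Theorems.KolyvaginRoadThreeMethod2Step
import Mathlib.RingTheory.Coprime.Lemmas
import HarnessLib

/-!
# Route `AdditiveKolyvaginRoad`, crux `KolyvaginPrimitiveAdditive` (item stmt-BirchSwinnertonDyer-20132):
# the ONE-PRIME STEP for the p-generic canonical spaces — how `Sel_n^μ` changes from level `n` to `n ∪ {q}`
# (cell `pub/bsd-wall`, lead prover `bsd-wall-akr-p1`; `--supports stmt-BirchSwinnertonDyer-20132`, helper;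
# p-generic port of zhang3-p1's `Theorems/KolyvaginRoadThreeMethod2Step.lean`, proofs verbatim with `3 ↦ p`,
# ordinary ↦ TORIC, unipotent-admissible ↦ Bertolini–Darmon admissible)

Stub A1 (`stub_rankLoweringAdditive`, skeleton v5 of crux 20132) compares `SelQP W K p c (insert q n) μ` with
`SelQP W K p c n μ`. By DEFINITION (`Theorems/AdditiveKolyvaginRoadLevelDefs.lean`, p508832) the two spaces impose the
same conditions everywhere except at the places above `q`, where level `n` asks E's KUMMER condition and level
`n ∪ {q}` asks the TORIC condition `toricLocalKer` (W. Zhang 2014, (9.3): *"the local condition from A₂ differs from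
that from A₁ only at the place q₂"*). This file records that bookkeeping once, so that a prover of (A1) only has to
argue about the two local conditions AT `q` (Bertolini–Darmon Lemma 2.6 at an admissible prime for `p ≥ 5`: `H¹_fin`
and `H¹_ord` are complementary lines; Gross–Parson parity lemma ∕ Zhang Prop. 5.4):

* `levelSelmerSubgroupP_insert_inf_kummer_eq` — for `q ∉ n ∪ S` whose places are disjoint from those above `n ∪ S`:
  `Sel_{n∪q,S} ⊓ (Kummer above q) = Sel_{n,S} ⊓ (toric above q)`;
* corollaries `mem_levelSelmerSubgroupP_insert_of_toric` ∕ `mem_levelSelmerSubgroupP_of_insert_of_kummer`;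
* `disjoint_places_of_admQ`, `selQP_insert_inf_kummer_eq` — the same for the `ZMod p`-subspaces indexed by BD-admissible
  primes (distinct primes have disjoint places: zhang3-p1's `Method2.not_mem_asIdeal_of_coprime`, reused by import).

HONEST FRAMING. Unfolding of definitions; no arithmetic input, no named fact, no `sorry`, 0 defs; nothing about the
crux is asserted; nothing is booked. [cite: WZhang2014, §9 (9.3) and Prop. 5.4] [cite: BertoliniDarmon2005, §2.3]
-/

-- single-conjunct summit: `Summit.BirchSwinnertonDyer.BirchSwinnertonDyer.…` repeats the name by design
set_option linter.dupNamespace false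

noncomputable section

open scoped Classical

namespace Summit.BirchSwinnertonDyer.BirchSwinnertonDyer.Theorems.AdditiveKoly

open WeierstrassCurve NumberField IsDedekindDomain
  Literature.NumberTheory.EllipticCurves Literature.NumberTheory.GaloisRepresentations Module

variable (W : WeierstrassCurve ℚ) (K : Type) [Field K] [NumberField K] (p : ℕ) (c : K ≃ₐ[ℚ] K)

/-- **The one-prime step, as an identity of subgroups.** Let `q ∉ S` be a natural number none of whose places lies
above a member of `n ∪ S`. Then the level-`(n ∪ {q})` space cut back by E's Kummer condition above `q` equals the
level-`n` space cut by the toric condition above `q`: the two levels impose identical conditions away from `q`.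
[cite: WZhang2014, §9 (9.3)] -/
theorem levelSelmerSubgroupP_insert_inf_kummer_eq (n : Finset ℕ) (S : Set ℕ) (μ : Bool) {q : ℕ} (hqn : q ∉ n)
    (hqS : q ∉ S)
    (hdisj : ∀ v : HeightOneSpectrum (𝓞 K), (q : 𝓞 K) ∈ v.asIdeal → ∀ q' ∈ (n : Set ℕ) ∪ S, (q' : 𝓞 K) ∉ v.asIdeal) :
    levelSelmerSubgroupP W K p c (insert q n) S μ ⊓
        (⨅ (v : HeightOneSpectrum (𝓞 K)) (_ : (q : 𝓞 K) ∈ v.asIdeal),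
          selmerLocalKer (W.baseChange K) (v.adicCompletion K) ((p ^ 1 : ℕ) : ℤ)) =
      levelSelmerSubgroupP W K p c n S μ ⊓
        (⨅ (v : HeightOneSpectrum (𝓞 K)) (_ : (q : 𝓞 K) ∈ v.asIdeal),
          toricLocalKer (W.baseChange K) (v.adicCompletion K) ((p ^ 1 : ℕ) : ℤ)) := by
  ext x
  simp only [levelSelmerSubgroupP, AddSubgroup.mem_inf, AddSubgroup.mem_iInf, Finset.coe_insert]
  constructor
  · rintro ⟨⟨heig, hinf, hfin, hord⟩, hkq⟩
    refine ⟨⟨heig, hinf, fun v hv ↦ ?_, fun q' hq' v hv ↦ ?_⟩, fun v hv ↦ ?_⟩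
    · -- Kummer at the places above no member of n ∪ S
      by_cases hvq : (q : 𝓞 K) ∈ v.asIdeal
      · exact hkq v hvq
      · refine hfin v fun q' hq'' ↦ ?_
        rcases hq'' with hq'' | hq''
        · rcases Set.mem_insert_iff.mp hq'' with rfl | hq''
          · exact hvq
          · exact hv q' (Or.inl hq'')
        · exact hv q' (Or.inr hq'')
    · -- toric at n \ S
      exact hord q' ⟨Finset.mem_insert_of_mem hq'.1, hq'.2⟩ v hv
    · -- toric above q
      exact hord q ⟨Finset.mem_insert_self q n, hqS⟩ v hv
  · rintro ⟨⟨heig, hinf, hfin, hord⟩, hoq⟩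
    refine ⟨⟨heig, hinf, fun v hv ↦ ?_, fun q' hq' v hv ↦ ?_⟩, fun v hv ↦ ?_⟩
    · -- Kummer at the places above no member of (n ∪ {q}) ∪ S: a fortiori none of n ∪ S
      refine hfin v fun q' hq'' ↦ hv q' ?_
      rcases hq'' with hq'' | hq''
      · exact Or.inl (Set.mem_insert_of_mem _ hq'')
      · exact Or.inr hq''
    · -- toric at (n ∪ {q}) \ S
      rcases Finset.mem_insert.mp hq'.1 with rfl | hmem
      · exact hoq v hv
      · exact hord q' ⟨hmem, hq'.2⟩ v hv
    · -- Kummer above q: such a place lies above no member of n ∪ S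
      exact hfin v fun q' hq' ↦ hdisj v hv q' hq'

/-- **Going up is controlled by the toric condition at `q`**: a level-`n` class that is toric above `q` is a
level-`(n ∪ {q})` class. [cite: WZhang2014, §9 (9.3)] -/
theorem mem_levelSelmerSubgroupP_insert_of_toric (n : Finset ℕ) (S : Set ℕ) (μ : Bool) {q : ℕ} (hqn : q ∉ n)
    (hqS : q ∉ S)
    (hdisj : ∀ v : HeightOneSpectrum (𝓞 K), (q : 𝓞 K) ∈ v.asIdeal → ∀ q' ∈ (n : Set ℕ) ∪ S, (q' : 𝓞 K) ∉ v.asIdeal)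
    {x : Vp W K p} (hx : x ∈ levelSelmerSubgroupP W K p c n S μ)
    (hord : ∀ v : HeightOneSpectrum (𝓞 K), (q : 𝓞 K) ∈ v.asIdeal →
      x ∈ toricLocalKer (W.baseChange K) (v.adicCompletion K) ((p ^ 1 : ℕ) : ℤ)) :
    x ∈ levelSelmerSubgroupP W K p c (insert q n) S μ := by
  have h : x ∈ levelSelmerSubgroupP W K p c n S μ ⊓
      (⨅ (v : HeightOneSpectrum (𝓞 K)) (_ : (q : 𝓞 K) ∈ v.asIdeal),
        toricLocalKer (W.baseChange K) (v.adicCompletion K) ((p ^ 1 : ℕ) : ℤ)) :=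
    AddSubgroup.mem_inf.mpr ⟨hx, AddSubgroup.mem_iInf.mpr fun v ↦ AddSubgroup.mem_iInf.mpr fun hv ↦ hord v hv⟩
  rw [← levelSelmerSubgroupP_insert_inf_kummer_eq W K p c n S μ hqn hqS hdisj] at h
  exact (AddSubgroup.mem_inf.mp h).1

/-- **Going down is controlled by the Kummer condition at `q`**: a level-`(n ∪ {q})` class that is Kummer above `q`
is a level-`n` class (Zhang Prop. 5.4: the new Selmer group meets the old one in the kernel of `loc_q`).
[cite: WZhang2014, Prop. 5.4] -/
theorem mem_levelSelmerSubgroupP_of_insert_of_kummer (n : Finset ℕ) (S : Set ℕ) (μ : Bool) {q : ℕ} (hqn : q ∉ n)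
    (hqS : q ∉ S)
    (hdisj : ∀ v : HeightOneSpectrum (𝓞 K), (q : 𝓞 K) ∈ v.asIdeal → ∀ q' ∈ (n : Set ℕ) ∪ S, (q' : 𝓞 K) ∉ v.asIdeal)
    {x : Vp W K p} (hx : x ∈ levelSelmerSubgroupP W K p c (insert q n) S μ)
    (hkum : ∀ v : HeightOneSpectrum (𝓞 K), (q : 𝓞 K) ∈ v.asIdeal →
      x ∈ selmerLocalKer (W.baseChange K) (v.adicCompletion K) ((p ^ 1 : ℕ) : ℤ)) :
    x ∈ levelSelmerSubgroupP W K p c n S μ := by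
  have h : x ∈ levelSelmerSubgroupP W K p c (insert q n) S μ ⊓
      (⨅ (v : HeightOneSpectrum (𝓞 K)) (_ : (q : 𝓞 K) ∈ v.asIdeal),
        selmerLocalKer (W.baseChange K) (v.adicCompletion K) ((p ^ 1 : ℕ) : ℤ)) :=
    AddSubgroup.mem_inf.mpr ⟨hx, AddSubgroup.mem_iInf.mpr fun v ↦ AddSubgroup.mem_iInf.mpr fun hv ↦ hkum v hv⟩
  rw [levelSelmerSubgroupP_insert_inf_kummer_eq W K p c n S μ hqn hqS hdisj] at h
  exact (AddSubgroup.mem_inf.mp h).1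

variable [W.IsGloballyMinimal]

omit [NumberField K] in
/-- For a finite set `n` of admissible primes and an admissible `q ∉ n`, the places above `q` lie above no member
of `n` (distinct primes are coprime). [folklore] -/
theorem disjoint_places_of_admQ (n : Finset (AdmQ W K p))
    (S : Set (AdmQ W K p)) (q : AdmQ W K p) (hqn : q ∉ n) (hqS : q ∉ S) :
    ∀ v : HeightOneSpectrum (𝓞 K), ((q : ℕ) : 𝓞 K) ∈ v.asIdeal →
      ∀ q' ∈ ((n.image Subtype.val : Finset ℕ) : Set ℕ) ∪ Subtype.val '' S, (q' : 𝓞 K) ∉ v.asIdeal := by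
  intro v hv q' hq'
  have hne : (q : ℕ) ≠ q' := by
    rintro heq
    rcases hq' with hq' | hq'
    · rw [Finset.mem_coe, Finset.mem_image] at hq'
      obtain ⟨a, ha, ha'⟩ := hq'
      exact hqn (by rwa [show a = q from Subtype.ext (ha'.trans heq.symm)] at ha)
    · obtain ⟨a, ha, ha'⟩ := hq'
      exact hqS (by rwa [show a = q from Subtype.ext (ha'.trans heq.symm)] at ha)
  have hq'prime : q'.Prime := by
    rcases hq' with hq' | hq'
    · rw [Finset.mem_coe, Finset.mem_image] at hq'
      obtain ⟨a, -, rfl⟩ := hq'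
      exact a.2.1
    · obtain ⟨a, -, rfl⟩ := hq'
      exact a.2.1
  exact Summit.BirchSwinnertonDyer.Rank1Residual.X11b.Three.Koly.Method2.not_mem_asIdeal_of_coprime K ((Nat.coprime_primes q.2.1 hq'prime).mpr hne) v hv

/-- **The one-prime step for the canonical spaces `SelQP`** (as `ZMod p`-subspaces): for an admissible `q ∉ n`,
`SelQP (insert q n) μ ⊓ (Kummer above q) = SelQP n μ ⊓ (toric above q)`. [cite: WZhang2014, §9 (9.3) and
Prop. 5.4] -/
theorem selQP_insert_inf_kummer_eq [Module (ZMod p) (Vp W K p)] (n : Finset (AdmQ W K p))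
    (q : AdmQ W K p) (hqn : q ∉ n) (μ : Bool) :
    SelQP W K p c (insert q n) μ ⊓ AddSubgroup.toZModSubmodule p
        (⨅ (v : HeightOneSpectrum (𝓞 K)) (_ : ((q : ℕ) : 𝓞 K) ∈ v.asIdeal),
          selmerLocalKer (W.baseChange K) (v.adicCompletion K) ((p ^ 1 : ℕ) : ℤ)) =
      SelQP W K p c n μ ⊓ AddSubgroup.toZModSubmodule p
        (⨅ (v : HeightOneSpectrum (𝓞 K)) (_ : ((q : ℕ) : 𝓞 K) ∈ v.asIdeal),
          toricLocalKer (W.baseChange K) (v.adicCompletion K) ((p ^ 1 : ℕ) : ℤ)) := by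
  unfold SelQP
  rw [← map_inf, ← map_inf, Finset.image_insert]
  congr 1
  refine levelSelmerSubgroupP_insert_inf_kummer_eq W K p c _ _ μ ?_ (Set.notMem_empty _) ?_
  · rw [Finset.mem_image]
    rintro ⟨a, ha, ha'⟩
    exact hqn (by rwa [show a = q from Subtype.ext ha'] at ha)
  · simpa only [Set.image_empty] using disjoint_places_of_admQ W K p n ∅ q hqn (Set.notMem_empty _)

end Summit.BirchSwinnertonDyer.BirchSwinnertonDyer.Theorems.AdditiveKoly

end
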